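import Mathlib
import HarnessLib
import Summits.Parity.GeneralizedHardyLittlewood.Theses.LeeYangFibres
import Summits.Parity.GeneralizedHardyLittlewood.Theorems.LeeYangFibresFibreHyperbolicityDefs
import Summits.Parity.GeneralizedHardyLittlewood.Theorems.LeeYangFibresFibreHyperbolicityPerturb
import Summits.Parity.GeneralizedHardyLittlewood.Theorems.LeeYangFibresFibreHyperbolicityCoeffBound
import Summits.Parity.GeneralizedHardyLittlewood.Theorems.LeeYangFibresFibreHyperbolicityAssemble
import Summits.Parity.GeneralizedHardyLittlewood.Theorems.LeeYangFibresFibreHyperbolicityAPCells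
import Summits.Parity.GeneralizedHardyLittlewood.Theorems.LeeYangFibresFibreHyperbolicityLawOneAnalytic
import Summits.Parity.GeneralizedHardyLittlewood.Theorems.LeeYangFibresFibreHyperbolicityLawOneNorm

/-!
# Crux `FibreHyperbolicity` (stmt-Parity-14108): the case of ONE form is a theorem

The `t = 1` case of the crux `LeeYangFibres.FibreHyperbolicity` — real-rootedness of the Ω-cell polynomial of the
`N^{1/u}`-rough values of one non-degenerate linear form `a n + b` (`|a| + |b|/N ≤ L`) on a convex `K ⊆ [−N, N]`
carrying mass `β_∞ 𝔖 ≥ ηN`, cofinally in `u` (indeed for `u = max u₀ 2`) — PROVED unconditionally and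
parity-free, by the line "model transfer" (`Cruxes/FibreHyperbolicity/Lines/SketchIdeator1.lean`) from its landed
stubs: Alladi's asymptotic in a residue class (`stub_apCells`), the segment law (`stub_lawOneAnalytic`), the
Green–Tao normalisations (`stub_lawOneNorm`), the coefficient bound, the perturbation lemma, the simple real
zeros of the model polynomial (`WindowChainTransport.stub_simpleZeros`) and the composition `stub_assemble`.
This retires the route's kill criterion "FibreHyperbolicity refuted by a structural argument at `t = 1`".
The general case is closed modulo the ghost-free cell law `stub_ghostFree` (`t ≥ 2`, Hardy–Littlewood strength).
-/

noncomputable section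

namespace Summit.Parity.GeneralizedHardyLittlewood.Cruxes.FibreHyperbolicity.ModelTransfer

open scoped BigOperators Classical
open Finset
open Literature.NumberTheory.Sieve

/-- **`FibreHyperbolicity` at `t = 1` (registered corollary).** -/
theorem fibreHyperbolicityAt_one : FHAt 1 :=
  stub_assemble 1 le_rfl stub_perturb stub_coeffBound fibreExpand (stub_lawOneNorm (stub_lawOneAnalytic stub_apCells))

/-- **`FibreHyperbolicity` at `t = 1`, verbatim**: the crux's own text with `t := 1`. -/
theorem fibreHyperbolicity_one :
    ∀ (L u₀ : ℕ) (η : ℝ), 0 < η → ∃ u : ℕ, u₀ ≤ u ∧ 2 ≤ u ∧ ∃ N₀ : ℕ, ∀ N : ℕ, N₀ ≤ N →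
      ∀ Ψ : Fin 1 → AffLinForm 1, IsNondegenerateSystem Ψ → affLinSize Ψ N ≤ L →
      ∀ K : Set (Fin 1 → ℝ), Convex ℝ K → K ⊆ realBox 1 N →
      η * (N : ℝ) ≤ archFactor Ψ K * singularProduct Ψ →
      ∀ i : Fin 1, ∀ w : Fin 1 → ℝ, (∀ k, 0 < w k ∧ w k ≤ 1) → ∀ ζ : ℂ,
        (∑ j ∈ Fintype.piFinset (fun _ : Fin 1 => Finset.Icc 1 u),
          ((((latticeBox 1 N).filter (fun n => realPoint n ∈ K ∧
              ∀ k, (N : ℝ) ^ ((1 : ℝ) / u) < (Nat.minFac ((Ψ k).eval n).toNat : ℝ) ∧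
                ArithmeticFunction.cardFactors ((Ψ k).eval n).toNat = j k)).card : ℕ) : ℂ) *
            ∏ k, (if k = i then ζ else ((w k : ℝ) : ℂ)) ^ (j k)) = 0 → ζ.im = 0 :=
  fibreHyperbolicityAt_one

end Summit.Parity.GeneralizedHardyLittlewood.Cruxes.FibreHyperbolicity.ModelTransfer

end
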